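import Mathlib
import Summits.NavierStokesRegularity.NavierStokesRegularity.Theorems.EulerZoomLiouvillePowerGaugeEulerLiouvilleSelfSimilarPressureCapacityFrostman
import Summits.NavierStokesRegularity.NavierStokesRegularity.Theorems.EulerZoomLiouvillePowerGaugeEulerLiouvilleSelfSimilarPressureParkingMember
import HarnessLib

/-!
# THE PRESSURISED SET IS TWO-DIMENSIONALLY SMALL — MEMBER FORM (crux binders verbatim)
# (crux `EulerZoomLiouville.PowerGaugeEulerLiouville` = stmt-NavierStokesRegularity-19832, THE ONE STATEMENT, T2 face «capacity margin»; width seat ns-ezl-w1 g5)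

Route №10 `EulerZoomLiouville` (NavierStokesRegularity).  The profile-level Frostman bound `PressureParking.measure_pressurised_le_of_frostman_rpow`
(`…SelfSimilarPressureCapacityFrostman`) fed with the class data exactly as g4's `…PressureParkingMember`: the `E`-gauge of the profile
(`NeedleThinCore.selfSimilar_shell_inputs`, `c_E = (1−ρ)c/(2+ρ)`), the weighted `D`-datum of the normalised classical pressure `P′ + c₀`
(`profile_pressure_weight_of_gaugeD`, bridge `WeakToClassical.pressureProfile_ae_eq_add_const`), and the class average bound
`integral_probeBump_pressure_le` (`∫ χ_R P′(x₀+·) ≤ κL² + C L^{1−2ρ}/R³`) at the averaging radius `R_L = ((C/κ+1)L^{−1−2ρ})^{1/3} ≤ L`, where the average is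
`≤ 2κL²`, so that every point of `B̄_L` with `P′ + c₀ ≥ 3κL²` has excess `≥ κL²`:

* **`measure_pressurised_member_le_of_frostman`** — for an exactly self-similar in-class member (`0 < ρ < 1`) with `C²` profile `V`, ANY classical pressure `P′`
  of `V` and every `κ > 0` there are the bridge constant `c₀` (`P = P′ + c₀` a.e.) and `L₁ ≥ 1` such that for every `L ≥ L₁` and EVERY finite 2-Frostman measure
  `ν` (`ν(B(z,r)) ≤ A r²`):  `ν({‖y‖ ≤ L, P′ y + c₀ ≥ 3κL²}) ≤ 4A (12·3^{1−ρ} c_E/(m κ))² · L^{−2−2ρ}`.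

READING: every planar or spherical section (area measure, `A = π` resp. `≤ 4π`), every rectifiable surface patch of bounded density and every slab per unit
thickness meets the far pressurised set `{P′ + c₀ ≥ 3κ‖y‖²}` of a class member in measure `≲ (c/κ)² L^{−2−2ρ}`; the pressurised patch on EVERY sphere of radius
`≍ L` has angular size `≲ L^{−4−2ρ}`.  HONEST LABEL: portrait stratum; nothing here excludes a needle (a radial segment is invisible to 2-Frostman measures).
WHAT THIS IS NOT: not NS, not E — `--supports` stmt-19832 on the MODEL lattice; 19832 OPEN; NS regularity NOT proved. [folklore; Landkof 1972 Ch. II §1, III §4]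
-/

noncomputable section

-- flat `Theorems/<Route><Decl>…` files of one crux share the namespace of the crux (tree convention)
set_option linter.dupNamespace false

open MeasureTheory Set Filter Topology Metric Function InnerProductSpace
open scoped RealInnerProductSpace NNReal ENNReal

namespace Summit.NavierStokesRegularity.NavierStokesRegularity.Theorems.PowerGaugeEulerLiouville.PressureParking

open Literature.Analysis Literature.Analysis.FluidPDE

/-- **THE FAR PRESSURISED SET OF A CLASS MEMBER IS TWO-DIMENSIONALLY SMALL** (crux binders verbatim, `0 < ρ < 1`; see the module docstring).
[folklore; Landkof 1972 Ch. II §1, Ch. III §4; GilbargTrudinger2001 Thm 2.1] -/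
theorem measure_pressurised_member_le_of_frostman {ρ : ℝ} (hρ : 0 < ρ) (hρ1 : ρ < 1)
    {u : ℝ → EuclideanSpace ℝ (Fin 3) → EuclideanSpace ℝ (Fin 3)} {p : ℝ → EuclideanSpace ℝ (Fin 3) → ℝ}
    {H : ℝ → EuclideanSpace ℝ (Fin 3) → EuclideanSpace ℝ (Fin 3) →L[ℝ] EuclideanSpace ℝ (Fin 3)} {c : ℝ≥0}
    (hsw : IsSuitableWeakSolutionOn (slab (EuclideanSpace ℝ (Fin 3)) (Iio 0) isOpen_Iio) 0 0 u p)
    (hH : HasWeakSpatialGradientOn (slab (EuclideanSpace ℝ (Fin 3)) (Iio 0) isOpen_Iio) u H)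
    (hgauge : ∀ a : ℝ, 0 < a →
      ENNReal.ofReal (a ^ (2 * ρ)) * cknA a (0 : ℝ × EuclideanSpace ℝ (Fin 3)) u +
          ENNReal.ofReal (a ^ ρ) * cknE a (0 : ℝ × EuclideanSpace ℝ (Fin 3)) H +
        ENNReal.ofReal (a ^ (2 * ρ)) * cknD a (0 : ℝ × EuclideanSpace ℝ (Fin 3)) p ≤ (c : ℝ≥0∞))
    {V : EuclideanSpace ℝ (Fin 3) → EuclideanSpace ℝ (Fin 3)} {P : EuclideanSpace ℝ (Fin 3) → ℝ}
    (hu : ∀ τ : ℝ, τ < 0 → u τ = selfSimilarCollapse (1 / (2 + ρ)) 0 V τ)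
    (hp : ∀ τ : ℝ, τ < 0 → p τ = selfSimilarCollapsePressure (1 / (2 + ρ)) 0 P τ)
    (hV : ContDiff ℝ 2 V) {P' : EuclideanSpace ℝ (Fin 3) → ℝ}
    (hprof : IsSelfSimilarEulerProfile (1 / (2 + ρ)) 0 V P') {κ : ℝ} (hκ : 0 < κ) :
    ∃ c₀ L₁ : ℝ, 1 ≤ L₁ ∧ (P =ᵐ[volume] fun y => P' y + c₀) ∧
      ∀ L : ℝ, L₁ ≤ L → ∀ (ν : Measure (EuclideanSpace ℝ (Fin 3))) [IsFiniteMeasure ν] (A : ℝ), 0 < A →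
        (∀ (z : EuclideanSpace ℝ (Fin 3)) (r : ℝ), 0 < r → ν (ball z r) ≤ ENNReal.ofReal (A * r ^ 2)) →
        (ν {y : EuclideanSpace ℝ (Fin 3) | ‖y‖ ≤ L ∧ 3 * κ * L ^ 2 ≤ P' y + c₀}).toReal ≤
          4 * A * (12 * (3 : ℝ) ^ (1 - ρ) * ((1 - ρ) / (2 + ρ) * c) / (baseBumpMass (EuclideanSpace ℝ (Fin 3)) * κ)) ^ 2 *
            L ^ (-2 - 2 * ρ) := by
  have h2ρ : (0 : ℝ) < 2 + ρ := by linarith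
  -- the class pressure profile and its weighted `D`-datum (verbatim from `…PressureParkingMember`)
  have hD : ∀ a : ℝ, 0 < a → ENNReal.ofReal (a ^ (2 * ρ)) *
      cknD a (0 : ℝ × EuclideanSpace ℝ (Fin 3)) p ≤ (c : ℝ≥0∞) :=
    fun a ha => le_trans le_add_self (hgauge a ha)
  have hpm : AEStronglyMeasurable (uncurry p)
      (volume.restrict (Iio (0 : ℝ) ×ˢ (univ : Set (EuclideanSpace ℝ (Fin 3))))) := by
    have := hsw.distributional.2.2.1.aestronglyMeasurable
    simpa [slab] using this
  have hPm := aestronglyMeasurable_pressureProfile hpm hp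
  have hDprof := profile_pressure_weight_of_gaugeD hρ hρ1 hpm hp hD
  have hP1 : LocallyIntegrable P volume :=
    EnergySaturation.locallyIntegrable_pressure_of_weight hρ1 hPm
      (ENNReal.mul_ne_top ENNReal.ofReal_ne_top ENNReal.coe_ne_top) hDprof
  obtain ⟨c₀, hc₀⟩ := WeakToClassical.pressureProfile_ae_eq_add_const hsw.distributional hu hp hV hP1 hprof
  have hprof'' : IsSelfSimilarEulerProfile (1 / (2 + ρ)) 0 V (fun y => P' y + c₀) := hprof.add_const
  have hCD : (0 : ℝ) ≤ (2 - 2 * ρ) / (2 + ρ) * c := by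
    have : (0 : ℝ) ≤ (2 - 2 * ρ) / (2 + ρ) := div_nonneg (by linarith) h2ρ.le
    exact mul_nonneg this (NNReal.coe_nonneg c)
  have hD'' : ∫⁻ y, ‖P' y + c₀‖ₑ ^ (3 / 2 : ℝ) * ENNReal.ofReal (‖y‖ ^ (2 * ρ - 2)) ≤
      ENNReal.ofReal ((2 - 2 * ρ) / (2 + ρ) * c) := by
    have e : (fun y : EuclideanSpace ℝ (Fin 3) => ‖P' y + c₀‖ₑ ^ (3 / 2 : ℝ) * ENNReal.ofReal (‖y‖ ^ (2 * ρ - 2))) =ᵐ[volume]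
        fun y => ‖P y‖ₑ ^ (3 / 2 : ℝ) * ENNReal.ofReal (‖y‖ ^ (2 * ρ - 2)) := by
      filter_upwards [hc₀] with y hy
      rw [hy]
    rw [lintegral_congr_ae e]
    refine hDprof.trans (le_of_eq ?_)
    rw [ENNReal.ofReal_mul (by apply div_nonneg <;> linarith), ENNReal.ofReal_coe_nnreal]
  -- the `E`-growth of the profile
  have hV1 : ContDiff ℝ 1 V := hV.of_le (by norm_num)
  set cE : ℝ := (1 - ρ) / (2 + ρ) * c with hcEdef
  have hE : ∀ L : ℝ, 0 < L → ∫⁻ y in ball (0 : EuclideanSpace ℝ (Fin 3)) L, ‖fderiv ℝ V y‖ₑ ^ 2 ≤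
      ENNReal.ofReal (cE * L ^ (1 - ρ)) := fun L hL =>
    (NeedleThinCore.selfSimilar_shell_inputs hρ hρ1 hsw hH hgauge hu hp hV1 hL).1
  have hcE : (0 : ℝ) ≤ cE := by
    have : (0 : ℝ) ≤ (1 - ρ) / (2 + ρ) := div_nonneg (by linarith) h2ρ.le
    exact mul_nonneg this (NNReal.coe_nonneg c)
  -- the class average bound at level `κ`
  obtain ⟨C, L₁, hC, hL₁, havg⟩ := integral_probeBump_pressure_le hprof'' hρ1 hCD hD'' hκ
  have hCk : 0 < C / κ + 1 := by positivity
  refine ⟨c₀, max L₁ (C / κ + 1), le_trans hL₁ (le_max_left _ _), hc₀, fun L hL ν _ A hA hν => ?_⟩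
  have hLL₁ : L₁ ≤ L := (le_max_left _ _).trans hL
  have hLC : C / κ + 1 ≤ L := (le_max_right _ _).trans hL
  have hL1 : 1 ≤ L := hL₁.trans hLL₁
  have hL0 : 0 < L := one_pos.trans_le hL1
  -- the averaging radius `R = ((C/κ+1) L^{−1−2ρ})^{1/3} ≤ L`
  obtain ⟨Aκ, hAκ⟩ : ∃ Aκ : ℝ, Aκ = (C / κ + 1) * L ^ (-1 - 2 * ρ) := ⟨_, rfl⟩
  have hAκ0 : 0 < Aκ := by rw [hAκ]; exact mul_pos hCk (Real.rpow_pos_of_pos hL0 _)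
  obtain ⟨R, hRdef⟩ : ∃ R : ℝ, R = Aκ ^ (1 / 3 : ℝ) := ⟨_, rfl⟩
  have hR0 : 0 < R := by rw [hRdef]; exact Real.rpow_pos_of_pos hAκ0 _
  have hR3 : R ^ 3 = Aκ := by
    rw [hRdef, ← Real.rpow_natCast, ← Real.rpow_mul hAκ0.le]; norm_num
  have hLpow1 : L ^ (-1 - 2 * ρ) ≤ 1 := Real.rpow_le_one_of_one_le_of_nonpos hL1 (by linarith)
  have hAκle : Aκ ≤ C / κ + 1 := by
    rw [hAκ]
    calc (C / κ + 1) * L ^ (-1 - 2 * ρ) ≤ (C / κ + 1) * 1 := mul_le_mul_of_nonneg_left hLpow1 hCk.le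
      _ = C / κ + 1 := mul_one _
  have hRL : R ≤ L := by
    have h1 : (1 : ℝ) ≤ C / κ + 1 := by linarith [div_nonneg hC hκ.le]
    have hR1 : R ≤ C / κ + 1 := by
      rw [hRdef]
      calc Aκ ^ (1 / 3 : ℝ) ≤ (C / κ + 1) ^ (1 / 3 : ℝ) := Real.rpow_le_rpow hAκ0.le hAκle (by norm_num)
        _ ≤ (C / κ + 1) ^ (1 : ℝ) := Real.rpow_le_rpow_of_exponent_le h1 (by norm_num)
        _ = C / κ + 1 := Real.rpow_one _
    exact hR1.trans hLC
  -- at radius `R` the average is `≤ 2κL²`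
  have hCterm : C * L ^ (1 - 2 * ρ) / R ^ 3 ≤ κ * L ^ 2 := by
    rw [hR3, div_le_iff₀ hAκ0, hAκ]
    have e1 : L ^ (1 - 2 * ρ) = L ^ 2 * L ^ (-1 - 2 * ρ) := by
      rw [← Real.rpow_natCast, ← Real.rpow_add hL0]
      congr 1
      push_cast
      ring
    rw [e1]
    have hLpow : 0 < L ^ (-1 - 2 * ρ) := Real.rpow_pos_of_pos hL0 _
    have : C * (L ^ 2 * L ^ (-1 - 2 * ρ)) = (C / κ) * (κ * L ^ 2) * L ^ (-1 - 2 * ρ) := by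
      field_simp
    rw [this]
    have hx : 0 < κ * L ^ 2 * L ^ (-1 - 2 * ρ) := mul_pos (mul_pos hκ (pow_pos hL0 2)) hLpow
    have e2 : κ * L ^ 2 * ((C / κ + 1) * L ^ (-1 - 2 * ρ)) =
        C / κ * (κ * L ^ 2) * L ^ (-1 - 2 * ρ) + κ * L ^ 2 * L ^ (-1 - 2 * ρ) := by ring
    rw [e2]
    linarith
  -- the excess set
  set S : Set (EuclideanSpace ℝ (Fin 3)) := {y | ‖y‖ ≤ L ∧ 3 * κ * L ^ 2 ≤ P' y + c₀} with hSdef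
  have hPc : Continuous fun y => P' y + c₀ := hprof''.contDiff_pressure.continuous
  have hSm : MeasurableSet S :=
    (isClosed_le continuous_norm continuous_const).measurableSet.inter (isClosed_le continuous_const hPc).measurableSet
  have hS : ∀ x₀ ∈ S, ‖x₀‖ ≤ L ∧ κ * L ^ 2 + ∫ y, probeBump R y * (fun y => P' y + c₀) (x₀ + y) ≤ (fun y => P' y + c₀) x₀ := by
    intro x₀ hx₀
    refine ⟨hx₀.1, ?_⟩
    have havg' := havg L hLL₁ x₀ hx₀.1 R hR0 hRL
    have h3 : 3 * κ * L ^ 2 ≤ P' x₀ + c₀ := hx₀.2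
    simp only
    linarith
  exact measure_pressurised_le_of_frostman_rpow hprof'' hcE hE hL1 hR0 hRL hκ hSm hS ν hA hν

end Summit.NavierStokesRegularity.NavierStokesRegularity.Theorems.PowerGaugeEulerLiouville.PressureParking

end
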